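import Mathlib
import Literature.AlgebraicGeometry.HodgeTheory.WeilClassesBlochSeed
import Literature.AlgebraicGeometry.HodgeTheory.WeilTypeIsogenyClassSquares
import Literature.AlgebraicGeometry.HodgeTheory.AbelianVarietyMultiplicationPullback
import Literature.AlgebraicGeometry.HodgeTheory.AbelianVarietyEndomorphismsHOne
import Summits.HodgeConjecture.HodgeConjecture.Theses.EightfoldBlochSeeds
import Summits.HodgeConjecture.HodgeConjecture.Theses.EightfoldTwistedSheafSeeds
import Summits.HodgeConjecture.HodgeConjecture.Theorems.EightfoldBlochSeedsBlochSeedsGenericPad4SeedMinimalClauses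
import HarnessLib

/-!
# Route `EightfoldBlochSeeds`, crux `BlochSeedsGeneric` (item stmt-HodgeConjecture-18880; siblings `BlochSeedDiscOne` 18881,
# `BlochSeedDiscThree` 18882): THE SEED PREDICATE DEPENDS ON `d` ONLY THROUGH ITS SQUARE CLASS —
# `HasHyperbolicBlochSeed n d → HasHyperbolicBlochSeed n (N²·d)`, and the ∀d crux reduces BY NAME to `d = 1`, `d = 3` and the
# square-free discriminants `d ∉ {1, 3}`

HONEST FRAMING. Nothing here proves a registered stub, the crux `BlochSeedsGeneric`, its siblings, rung H2, HC_AV or the Hodge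
conjecture; nothing is constructed (no subscheme, no bundle, no section). UNCONDITIONAL `--supports` lemmas only: no named fact is
taken as a hypothesis, no definition and no Literature fact is introduced (D-0026). Census-neutral.

WHAT IS HERE (leafhand `leafhand-hodge-eightfoldblochseed-1-g2`, refill order 2026-08-30T22:31:52Z (1), successor of g0/g1). The crux
`BlochSeedsGeneric = ∀ d ≥ 1, d ≠ 1, 3 → HasHyperbolicBlochSeed 4 d` quantifies over EVERY positive integer `d`, but the seed
predicate only sees the field `K = ℚ(√-d) = ℚ(√-(N²d))`: on the SAME abelian variety `P` with the SAME embedding, Weil class and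
seed, the rescaled generator `N·ψ₀` (`(Nψ₀)² = -N²d`, the tree's `nsmul_comp_nsmul`) witnesses `HasHyperbolicBlochSeed n (N²d)`:

* §1 `complexBetti_map_nsmul_two` — `(N·ψ)^* = N²·ψ^*` on `H²` (`N·ψ = ψ ≫ [N]`, `[N]^* = N²` on `H²`: the tree's
  `complexBetti_map_nsmul_id_apply`), whence the `K`-symmetrised hyperplane class rescales: `N²d·e^*a + (Nψ)^*e^*a = N²·h_K`
  (`ksymm_nsmul_eq_smul`).
* §2 `weilClassesPlus/Minus/Of_le_nsmul` — `W_K(P, ψ, d) ≤ W_K(P, Nψ, N²d)` (`x·𝟙 + y·(Nψ) = x·𝟙 + (yN)·ψ` and `√(N²d) = N√d`: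
  the Weil characters match; no cohomology needed). HONEST OVERLAP: the tree's
  `Ring2.AbelianAll.weilClassesOf_zsmul_sq_mul` (file `Ring2AbelianAllWeilIsogenyDescent`, seat ab-weil-1) proves the EQUALITY
  `W_K(B, mψ, m²d) = W_K(B, ψ, d)` in the `ℤ`-spelling under `m, d ≠ 0`, `ψ² = -d` (via `pullbackEigenclasses_pow_eq_of_eq_eval₂`);
  here only the hypothesis-free inclusion in the `ℕ`-spelling of `HasHyperbolicBlochSeed` is needed, proved in five lines without
  that import cone — credited, not claimed. The same programme's `Ring2AbelianAllWeilSquarefree` re-indexes `WeilAlgebraicAll n d`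
  by square-free `d`; §4–§5 below are the analogue for the SEED predicate (new: the hyperbolicity and seed clauses).
* §3 `isHyperbolicWeilType_nsmul` — a `ψ^*`-stable rational Lagrangian frame is `(Nψ)^*`-stable (`(Nψ)^* = N·ψ^*` on `H¹`, the
  tree's `complexBetti_map_nsmul_one`).
* §4 `hasHyperbolicBlochSeed_nsmul_sq` — **`HasHyperbolicBlochSeed n d → HasHyperbolicBlochSeed n (N² * d)`** (`N ≥ 1`), assembling
  §1–§3 with the landed bridges `isHyperbolicWeilType_smul_iff` and `hasBlochSeedAt_ratSmul_iff` (`q ↦ q / N^{2n}`).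
* §5 BY-NAME CONSEQUENCES FOR THE ROUTE: `hasHyperbolicBlochSeed_sq_of_blochSeedDiscOne` (the `d = 1` crux gives every perfect
  square `d = N²`, i.e. the instances `d = 4, 9, 16, …` of `BlochSeedsGeneric`), `hasHyperbolicBlochSeed_three_mul_sq_of_blochSeedDiscThree`
  (`d = 3N²`), and **`blochSeedsGeneric_of_squarefree`**: `BlochSeedDiscOne ∧ BlochSeedDiscThree ∧ (seeds for every SQUARE-FREE
  `d ∉ {1, 3}`) ⟹ `BlochSeedsGeneric` (every `d = N²·d₀` with `d₀` square-free, Mathlib `Nat.sq_mul_squarefree`), for both route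
  files `Theses.EightfoldBlochSeeds` and `Theses.EightfoldTwistedSheafSeeds` (the shared item's two homes).
So the generic crux is honestly a statement about square-free discriminants `d₀ ≥ 2`, `d₀ ≠ 3`, and its instances in the square
classes of `1` and `3` are closed by the sibling cruxes; the registered pad4 stubs are untouched (they quantify over ALL CM data
`(E₀, ψ₀)` with `ψ₀² = -d`, which for `d = N²d₀` includes curves with CM by the non-maximal order `ℤ[N√-d₀]`). NOT here: the
descending direction `N²d ↦ d` — the tree divides `φ'` by `N` along an isogeny (`Ring2.AbelianAll.exists_isogeny_sq_descent`), but a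
Bloch seed is not known to transport along an isogeny (integrality and Bloch-semiregularity of the étale pre-image are not formal).

## References

[cite: vanGeemen1994HodgeAV, 4.9 and Lemma 5.2] [cite: MumfordAV1970, §19 (multiplication by `n`)] [cite: Bloch1972Semiregularity, Remark (7.5)]
[cite: HatcherAT2002, §3.2]
-/

noncomputable section

-- single-problem summit (Problem = Summit): the mandated namespace repeats `HodgeConjecture`.
set_option linter.dupNamespace false

open CategoryTheory AlgebraicGeometry
open Literature.AlgebraicGeometry Literature.AlgebraicGeometry.Motives Literature.AlgebraicGeometry.HodgeTheory
open Literature.AlgebraicTopology.SingularHomology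

namespace Summit.HodgeConjecture.HodgeConjecture.Theorems

/-! ## §1 `(N·ψ)^* = N²·ψ^*` on `H²` and the rescaled `K`-symmetrised class -/

section DegreeTwo

variable {P : AbelianVariety ℂ} (ψ : P ⟶ P)

/-- `√(N²·d) = N·√d` as complex numbers (`N, d : ℕ`). [folklore] -/
theorem sqrt_sq_mul_natCast (N d : ℕ) :
    (Real.sqrt ((N ^ 2 * d : ℕ) : ℝ) : ℂ) = (N : ℂ) * (Real.sqrt (d : ℝ) : ℂ) := by
  rw [Nat.cast_mul, Nat.cast_pow, Real.sqrt_mul (sq_nonneg _), Real.sqrt_sq (Nat.cast_nonneg _), Complex.ofReal_mul,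
    Complex.ofReal_natCast]

/-- **`(N·ψ)^* = N²·ψ^*` on `H²(P(ℂ); ℂ)`**: `N·ψ = ψ ≫ [N]_P` and `[N]^* = N²` on `H²` of an abelian variety (Mumford §19; the
tree's `complexBetti_map_nsmul_id_apply`). [cite: MumfordAV1970, §19] -/
theorem complexBetti_map_nsmul_two (N : ℕ) (x : complexBetti P.X 2) :
    complexBetti.map (N • ψ).hom.hom.hom 2 x = ((N : ℂ) ^ 2) • complexBetti.map ψ.hom.hom.hom 2 x := by
  have hcomp : N • ψ = ψ ≫ (N • 𝟙 P) := by rw [Preadditive.comp_nsmul, Category.comp_id]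
  rw [hcomp]
  have h := abelianVariety_map_map_apply (A := P) ψ (N • 𝟙 P) x
  change singularCohomology.map ℂ ℂ (AlgPoints.mapContinuous (L := ℂ) (ψ ≫ (N • 𝟙 P)).hom.hom.hom) 2 x = _
  rw [← h]
  have hN := complexBetti_map_nsmul_id_apply P N 2 x
  change singularCohomology.map ℂ ℂ (AlgPoints.mapContinuous (L := ℂ) (N • 𝟙 P).hom.hom.hom) 2 x = _ at hN
  rw [hN, map_smul]

/-- **The `K`-symmetrised hyperplane class rescales by `N²`**: `N²d·x + (Nψ)^*x = N²·(d·x + ψ^*x)`, the scalar written as the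
rational number `N²` (the shape consumed by `hasBlochSeedAt_ratSmul_iff` and `isHyperbolicWeilType_smul_iff`).
[cite: vanGeemen1994HodgeAV, Lemma 5.2 (1)] -/
theorem ksymm_nsmul_eq_smul (N d : ℕ) (x : complexBetti P.X 2) :
    ((N ^ 2 * d : ℕ) : ℂ) • x + complexBetti.map (N • ψ).hom.hom.hom 2 x =
      (((N ^ 2 : ℚ)) : ℂ) • ((d : ℂ) • x + complexBetti.map ψ.hom.hom.hom 2 x) := by
  rw [complexBetti_map_nsmul_two, smul_add, smul_smul]
  push_cast
  rfl

end DegreeTwo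

/-! ## §2 The Weil plane of `(P, ψ, d)` lies in the Weil plane of `(P, Nψ, N²d)` -/

section WeilPlane

variable {P : AbelianVariety ℂ} (ψ : P ⟶ P) {n d : ℕ}

/-- `x·𝟙 + y·(N·ψ) = x·𝟙 + (y·N)·ψ` in `End(P)`. [folklore] -/
theorem nsmul_id_add_nsmul_nsmul (x y N : ℕ) : (x • 𝟙 P + y • (N • ψ) : P ⟶ P) = x • 𝟙 P + (y * N) • ψ := by
  rw [mul_smul]

/-- `E₊(P, ψ, d) ≤ E₊(P, Nψ, N²d)`: the `+`-Weil character of `x·𝟙 + y·Nψ` for `√-(N²d)` is the `+`-Weil character of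
`x·𝟙 + (yN)·ψ` for `√-d`. [cite: vanGeemen1994HodgeAV, 4.9] -/
theorem weilClassesPlus_le_nsmul (N : ℕ) : weilClassesPlus P ψ n d ≤ weilClassesPlus P (N • ψ) n (N ^ 2 * d) := by
  intro c hc
  rw [mem_weilClassesPlus_iff] at hc ⊢
  intro x y
  rw [nsmul_id_add_nsmul_nsmul ψ x y N, hc x (y * N), sqrt_sq_mul_natCast]
  push_cast
  ring_nf

/-- `E₋(P, ψ, d) ≤ E₋(P, Nψ, N²d)`. [cite: vanGeemen1994HodgeAV, 4.9] -/
theorem weilClassesMinus_le_nsmul (N : ℕ) : weilClassesMinus P ψ n d ≤ weilClassesMinus P (N • ψ) n (N ^ 2 * d) := by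
  intro c hc
  rw [mem_weilClassesMinus_iff] at hc ⊢
  intro x y
  rw [nsmul_id_add_nsmul_nsmul ψ x y N, hc x (y * N), sqrt_sq_mul_natCast]
  push_cast
  ring_nf

/-- **`W_K(P, ψ, d) ≤ W_K(P, Nψ, N²d)`**: the Weil plane is insensitive to rescaling the generator of `K = ℚ(√-d)` (van Geemen 4.9:
the `K`-structure is `K ↪ End⁰(P)`, not the generator). [cite: vanGeemen1994HodgeAV, 4.9] -/
theorem weilClassesOf_le_nsmul (N : ℕ) : weilClassesOf P ψ n d ≤ weilClassesOf P (N • ψ) n (N ^ 2 * d) :=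
  sup_le_sup (weilClassesPlus_le_nsmul ψ N) (weilClassesMinus_le_nsmul ψ N)

end WeilPlane

/-! ## §3 Hyperbolicity is insensitive to rescaling the generator -/

section Hyperbolic

variable {P : AbelianVariety ℂ} (ψ : P ⟶ P) {n : ℕ} {h : complexBetti P.X 2}

/-- **A `ψ^*`-stable rational Lagrangian frame is `(Nψ)^*`-stable** (`(Nψ)^* = N·ψ^*` on `H¹`, the tree's
`complexBetti_map_nsmul_one`), so `IsHyperbolicWeilType P ψ n h → IsHyperbolicWeilType P (N·ψ) n h`.
[cite: vanGeemen1994HodgeAV, Lemma 5.2 (2)–(3) and 5.4] -/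
theorem isHyperbolicWeilType_nsmul (N : ℕ) (hh : IsHyperbolicWeilType P ψ n h) : IsHyperbolicWeilType P (N • ψ) n h := by
  obtain ⟨u, hrat, hli, hstab, hiso⟩ := hh
  refine ⟨u, hrat, hli, fun i => ?_, hiso⟩
  have hfun : complexBetti.map (N • ψ).hom.hom.hom 1 (u i) = (N : ℂ) • complexBetti.map ψ.hom.hom.hom 1 (u i) := by
    change (complexBetti.map (N • ψ).hom.hom.hom 1).hom (u i) = _
    rw [complexBetti_map_nsmul_one, ModuleCat.hom_nsmul, LinearMap.smul_apply, Nat.cast_smul_eq_nsmul]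
  rw [hfun]
  exact Submodule.smul_mem _ _ (hstab i)

end Hyperbolic

/-! ## §4 The seed predicate in `d` and in `N²·d` -/

/-- **`HasHyperbolicBlochSeed n d → HasHyperbolicBlochSeed n (N²·d)`** (`N ≥ 1`): keep `P`, the embedding `e`, the rational
class `a`, the Weil class `w` and the seed `Z`; replace `ψ₀` by `N·ψ₀`. Then `(Nψ₀)² = -N²d` (`nsmul_comp_nsmul`), the new
`K`-symmetrised class is `N²·h_K` (§1), hyperbolicity and the seed clause are invariant under `h ↦ N²·h` (the tree's
`isHyperbolicWeilType_smul_iff`, the landed `hasBlochSeedAt_ratSmul_iff`) and under `ψ₀ ↦ Nψ₀` (§3), and `w` stays in the Weil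
plane (§2). [cite: vanGeemen1994HodgeAV, 4.9 and Lemma 5.2] [cite: Bloch1972Semiregularity, Remark (7.5)] -/
theorem hasHyperbolicBlochSeed_nsmul_sq {n d N : ℕ} (hN : 0 < N) (hS : HasHyperbolicBlochSeed n d) :
    HasHyperbolicBlochSeed n (N ^ 2 * d) := by
  obtain ⟨P, ψ₀, e, a, w, hP, hψ, ha, ha0, hhyp, hwW, hwrat, hw0, hseed⟩ := hS
  have hcq : ((N : ℚ) ^ 2 : ℚ) ≠ 0 := pow_ne_zero _ (Nat.cast_ne_zero.2 hN.ne')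
  have hc : ((((N : ℚ) ^ 2 : ℚ)) : ℂ) ≠ 0 := by exact_mod_cast hcq
  have hK := ksymm_nsmul_eq_smul ψ₀ N d (complexBetti.map e.ι 2 a)
  refine ⟨P, N • ψ₀, e, a, w, hP, nsmul_comp_nsmul hψ N, ha, ha0, ?_, weilClassesOf_le_nsmul ψ₀ N hwW, hwrat, hw0, ?_⟩
  · rw [hK, isHyperbolicWeilType_smul_iff hc]
    exact isHyperbolicWeilType_nsmul ψ₀ N hhyp
  · rw [hK, hasBlochSeedAt_ratSmul_iff hcq]
    exact hseed

/-! ## §5 By-name consequences for the route `EightfoldBlochSeeds` (and the shared home `EightfoldTwistedSheafSeeds`) -/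

/-- **The `d = 1` crux gives every perfect-square discriminant**: `BlochSeedDiscOne → HasHyperbolicBlochSeed 4 (N²)` for
`N ≥ 1` — the instances `d = 4, 9, 16, …` of `BlochSeedsGeneric`. [cite: vanGeemen1994HodgeAV, 4.9] -/
theorem hasHyperbolicBlochSeed_sq_of_blochSeedDiscOne (h₁ : Theses.EightfoldBlochSeeds.BlochSeedDiscOne) {N : ℕ} (hN : 0 < N) :
    HasHyperbolicBlochSeed 4 (N ^ 2) := by
  simpa using hasHyperbolicBlochSeed_nsmul_sq hN h₁

/-- **The `d = 3` crux gives every discriminant `3N²`**: `BlochSeedDiscThree → HasHyperbolicBlochSeed 4 (N²·3)` for `N ≥ 1` —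
the instances `d = 12, 27, 48, …` of `BlochSeedsGeneric`. [cite: vanGeemen1994HodgeAV, 4.9] -/
theorem hasHyperbolicBlochSeed_three_mul_sq_of_blochSeedDiscThree (h₃ : Theses.EightfoldBlochSeeds.BlochSeedDiscThree) {N : ℕ}
    (hN : 0 < N) : HasHyperbolicBlochSeed 4 (N ^ 2 * 3) :=
  hasHyperbolicBlochSeed_nsmul_sq hN h₃

/-- **Square-free reduction of the generic crux.** `BlochSeedsGeneric` follows BY NAME from the two sibling cruxes
`BlochSeedDiscOne`, `BlochSeedDiscThree` and hyperbolic Bloch seeds for the SQUARE-FREE discriminants `d₀ ∉ {1, 3}` only: every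
`d ≥ 1` is `N²·d₀` with `d₀` square-free (Mathlib `Nat.sq_mul_squarefree`), and §4 lifts a seed from `d₀` to `d`.
[cite: vanGeemen1994HodgeAV, 4.9] [cite: Bloch1972Semiregularity, Remark (7.5)] -/
theorem blochSeedsGeneric_of_squarefree (h₁ : Theses.EightfoldBlochSeeds.BlochSeedDiscOne)
    (h₃ : Theses.EightfoldBlochSeeds.BlochSeedDiscThree)
    (hsf : ∀ d₀ : ℕ, Squarefree d₀ → d₀ ≠ 1 → d₀ ≠ 3 → HasHyperbolicBlochSeed 4 d₀) :
    Theses.EightfoldBlochSeeds.BlochSeedsGeneric := by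
  intro d hd _ _
  obtain ⟨d₀, N, hNd, hsq⟩ := Nat.sq_mul_squarefree d
  have hN : 0 < N := by
    rcases Nat.eq_zero_or_pos N with h0 | h0
    · subst h0; simp at hNd; omega
    · exact h0
  rw [← hNd]
  by_cases h1 : d₀ = 1
  · subst h1; exact hasHyperbolicBlochSeed_nsmul_sq hN h₁
  by_cases h3 : d₀ = 3
  · subst h3; exact hasHyperbolicBlochSeed_nsmul_sq hN h₃
  exact hasHyperbolicBlochSeed_nsmul_sq hN (hsf d₀ hsq h1 h3)

/-- The same reduction for the shared home `Theses.EightfoldTwistedSheafSeeds.BlochSeedsGeneric` (the skeleton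
`Cruxes/BlochSeedsGeneric/Lines/pad4_cm_anchor.lean` concludes that copy), with the siblings read from route `EightfoldBlochSeeds`
(`BlochSeedDiscOne` lives only there) and `EightfoldTwistedSheafSeeds.BlochSeedDiscThree`. [cite: vanGeemen1994HodgeAV, 4.9] -/
theorem twisted_blochSeedsGeneric_of_squarefree (h₁ : Theses.EightfoldBlochSeeds.BlochSeedDiscOne)
    (h₃ : Theses.EightfoldTwistedSheafSeeds.BlochSeedDiscThree)
    (hsf : ∀ d₀ : ℕ, Squarefree d₀ → d₀ ≠ 1 → d₀ ≠ 3 → HasHyperbolicBlochSeed 4 d₀) :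
    Theses.EightfoldTwistedSheafSeeds.BlochSeedsGeneric :=
  blochSeedsGeneric_of_squarefree h₁ h₃ hsf

/-- **Conversely the generic crux together with the two siblings is exactly "all `d ≥ 1`"**: `BlochSeedsGeneric ∧ BlochSeedDiscOne ∧
BlochSeedDiscThree ↔ ∀ d ≥ 1, HasHyperbolicBlochSeed 4 d` (bookkeeping; the route's three seed cruxes partition the discriminants).
[cite: Bloch1972Semiregularity, Remark (7.5)] -/
theorem blochSeeds_all_iff :
    (Theses.EightfoldBlochSeeds.BlochSeedsGeneric ∧ Theses.EightfoldBlochSeeds.BlochSeedDiscOne ∧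
        Theses.EightfoldBlochSeeds.BlochSeedDiscThree) ↔ ∀ d : ℕ, 0 < d → HasHyperbolicBlochSeed 4 d := by
  constructor
  · rintro ⟨hg, h₁, h₃⟩ d hd
    by_cases hd1 : d = 1
    · subst hd1; exact h₁
    by_cases hd3 : d = 3
    · subst hd3; exact h₃
    exact hg d hd hd1 hd3
  · intro h
    exact ⟨fun d hd _ _ => h d hd, h 1 one_pos, h 3 (by norm_num)⟩

/-! ## §6 The H2 leaf needs hyperbolic Bloch seeds at SQUARE-FREE discriminants only (appended, leafhand 1-g2) -/

/-- **`WeilSixfolds` (rung H2) from Deligne's reach, Bloch's theorem at `(8, 4)` and hyperbolic Bloch seeds at the SQUARE-FREE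
discriminants only.** The route's deciding consumer `WeilTypeLadder.weilSixfolds_of_reach_of_blochSpread_of_seeds_four` asks for
`HasHyperbolicBlochSeed 4 d` at every `d ≥ 1`; by §4 every `d = N²·d₀` (`d₀` square-free, Mathlib `Nat.sq_mul_squarefree`) is served by
the seed at `d₀`. So the seed input of rung H2 is honestly indexed by the imaginary quadratic FIELDS `ℚ(√-d₀)`, not by the integers `d`.
[cite: Bloch1972Semiregularity, Thm. (7.4) and Remark (7.5)] [cite: vanGeemen1994HodgeAV, 4.9] -/
theorem weilSixfolds_of_reach_of_blochSpread_of_squarefree_seeds (hF : weilFamilyReach_hyperbolic)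
    (hB : BlochSemiregularSpread (2 * 4) 4) (hsf : ∀ d₀ : ℕ, 0 < d₀ → Squarefree d₀ → HasHyperbolicBlochSeed 4 d₀) :
    Theses.SevenfoldWeilCensus.WeilSixfolds :=
  WeilTypeLadder.weilSixfolds_of_reach_of_blochSpread_of_seeds_four hF hB fun d hd => by
    obtain ⟨d₀, N, hNd, hsq⟩ := Nat.sq_mul_squarefree d
    have hN : 0 < N := by
      rcases Nat.eq_zero_or_pos N with h0 | h0
      · subst h0; simp at hNd; omega
      · exact h0
    have hd₀ : 0 < d₀ := by
      rcases Nat.eq_zero_or_pos d₀ with h0 | h0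
      · subst h0; simp at hNd; omega
      · exact h0
    rw [← hNd]
    exact hasHyperbolicBlochSeed_nsmul_sq hN (hsf d₀ hd₀ hsq)

/-- The same in the route's item language: `ReachHyperbolic ∧ BlochSpreadEightFour ∧` (seeds at square-free `d₀`) `⟹ WeilSixfolds` —
the route's `closes` with its three seed cruxes `BlochSeedsGeneric`, `BlochSeedDiscOne`, `BlochSeedDiscThree` replaced by ONE
square-free-indexed seed hypothesis (by-name plumbing for the planner; no crux is proved). [cite: Bloch1972Semiregularity, Remark (7.5)] -/
theorem weilSixfolds_of_reachHyperbolic_of_blochSpreadEightFour_of_squarefree_seeds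
    (hF : Theses.EightfoldBlochSeeds.ReachHyperbolic) (hB : Theses.EightfoldBlochSeeds.BlochSpreadEightFour)
    (hsf : ∀ d₀ : ℕ, 0 < d₀ → Squarefree d₀ → HasHyperbolicBlochSeed 4 d₀) :
    Theses.SevenfoldWeilCensus.WeilSixfolds :=
  weilSixfolds_of_reach_of_blochSpread_of_squarefree_seeds hF hB hsf


end Summit.HodgeConjecture.HodgeConjecture.Theorems

end
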